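import Summits.Ventures.HSemireg.SecantParityWeilTypeHermitianDiscriminant
import Summits.Ventures.HSemireg.SecantParityWeilTypeSplit
import Literature.Geometry.Kaehler.ComplexTorusWeilTypeHermitianSignature
import Mathlib.RingTheory.Localization.Module
import HarnessLib

/-!
# Venture HSemireg — [Mar25 LEMMA 3.1.2] WITHOUT POSITIVITY: Markman's Hermitian `K`-form on `H₁(X × X̂, ℚ)` is HYPERBOLIC —
# `Re H` = the duality pairing, a MAXIMAL isotropic `K`-subspace of half the dimension, SIGNATURE `(n, n)` (`n = dim X`) — for EVERY
# secant direction `b`; TRACK S4-PUSH (ii), seat `s4-prove-1` (g15); file XIIh (sequel of XIIf `SecantParityWeilTypeSplit` and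
# XIIg `SecantParityWeilTypeHermitianDiscriminant`), record `s4push/prove-1/ATTEMPT-18.md`

HONEST FRAMING. Lean index of the computation cell `pub-hsemireg`; OBJECT LEVEL as in files XII–XIIg: `X = E/Φ(ℤ^ι)`,
`X × X̂ = prodPeriod Φ (dualPeriod Φ)`, `η ∈ NS(X)` NON-DEGENERATE with integer Gram matrix `G` — of ANY index: `±η` need not be a
polarisation — Markman's `A = (0 (ᵗG)⁻¹; -d·ᵗG 0)` (`A² = -d`, XIIb∕c), and the tree's Hermitian form `H(x, y) = Γ(x, A y) + √-d·Γ(x, y)`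
(Literature `WeilHermitian.hermForm`, Lange §7.3.3 Exercise (5)(a)) on the `K = ℚ(√-d)`-space `(H₁(X × X̂, ℚ), A)` for the block Gram
matrices `Γ(a, c) = (a·G 0; 0 c·(ᵗG)⁻¹)`, `a = c·d` (the rational Gram matrix of `c·Ξ_d`, XIIe; compatible with `A` for EVERY `η`, XIIg).
XIIg: the DISCRIMINANT of `H_Γ` is `[(-1)^{dim X}]` for every `η`; XIIf: an isotropic half for the POLARISED structures `h`. THIS file removes
the polarisation from the rest of [Mar25 §3.1 (3.1.2) ∕ Lemma 3.1.2]: (0) `Γ·A = -cd·(0 1; 1 0)`, i.e. **`Re H_Γ(x, y) = -cd·(x₁·y₂ + x₂·y₁)` is the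
duality pairing of `H₁(X, ℚ) ⊕ H₁(X̂, ℚ)` — independent of `η` altogether** (print (3.1.2): `H(x, y) := d(x, y)_V + √-d (f(x), y)_V`, only `f`
depends on the secant plane); (1) for EVERY non-degenerate `η`, `H_Γ` has an ISOTROPIC `K`-subspace `W` with `2·dim_K W = dim_K H₁(X × X̂, ℚ)`
(XIIf's witness `K ⊗ L`, `L` a Lagrangian half of a symplectic basis of `η` — a polarisation TYPE exists with no positivity), and NO isotropic
`K`-subspace is larger (Witt index `= dim X`); (2) by §1 (Hermitian linear algebra over `K`: a definite `K`-subspace meets an isotropic one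
trivially) in EVERY `H_Γ`-orthogonal `K`-basis exactly `dim X` diagonal entries are positive and exactly `dim X` negative — **the signature is
`(n, n)`** in the print's own sense («The signature of `H` is `(a,b)` if the `2n × 2n` diagonal Gram matrix … with respect to some orthogonal
`K`-basis … has `a` positive and `b` negative diagonal entries.» «The signature of `H` is `(n, n)`.»); definite `K`-subspaces of `dim_K = n` of
both signs exist (§1). With XIIg: (signature, discriminant) of Markman's Hermitian `K`-space = `((n, n), [(-1)ⁿ])` for EVERY secant direction —
BLIND to the index of `b` (seen only by the Riemann-form condition, XIId). §3: the lane's intermediate-index direction `η₄` on `E_τ⁴` (polarised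
for NEITHER orientation) has signature `(4, 4)`. Nothing here says that HC, HC_CM or HC_AV holds; nothing is a new case of anything; no
Weil-locus COMPONENT exists without a polarisation (XIId); (S3)'s signed words, STRUCTURE D6 and (S4) do not move; the identification of the
tree's `(X × X̂, A, Γ)` with the print's `(V_ℚ, f, (•,•)_V)` stays PAPER (ATTEMPT-15 §2). NO definition, NO named fact, NO sorry; theorems only
(one file-local `notation3` «Γ[a, c]» for the block Gram matrix). Landherr's classification is NOT in the tree and not invoked.

* §1 (any finite `K`-space, any Hermitian `H`, `K = ℚ(√-d)`): `finrank_add_finrank_le_of_pos_of_isotropic` ∕ `_neg_`, `two_mul_finrank_le_of_isotropic`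
  (Witt index `≤` half), **`card_pos_eq_and_card_neg_eq_of_isotropic_half`** (isotropic half ⇒ signature `(m, m)`), `exists_pos_neg_subspace_of_isotropic_half`.
* §2 (Markman's triple, no positivity): `blockGram_mul_weilMatrix`, **`hermForm_weilMatrix_re`**, **`exists_isotropic_half_hermForm_weilMatrix`**,
  **`hermForm_weilMatrix_re_eq_pairing`** (the same with Lange's `⟨ξ, v⟩ = Im ξ(v)`), `two_mul_finrank_le_of_isotropic_hermForm_weilMatrix`,
  **`card_pos_eq_and_card_neg_eq_hermForm_weilMatrix`** (general `…_blockGram_weilMatrix`). §3: **`card_pos_eq_and_card_neg_eq_hermForm_weilMatrix_eFour`** — `(4, 4)` on `E_τ⁴`.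

## References
* [Markman2025SecantWeil] = [Mar25] E. Markman, *Cycles on abelian 2n-folds of Weil type from secant sheaves on abelian n-folds*,
  arXiv:2502.03415 (2025), v2 §3.1: (3.1.2) `H(x, y) := d(x, y)_V + √-d (f(x), y)_V`; LEMMA 3.1.2 («`H` is an `SO₊(V_ℚ)_f`-invariant Hermitian
  form on `V_ℚ` considered as a `K`-vector space … The signature of `H` is `(n, n)`.», proof: «… that of `d` times the bilinear pairing on `V_ℚ`,
  which has signature `(2n, 2n)`. Hence, `a = b = n`.»); Lemma 3.1.3 (file XIIg); §1.2: `V := H¹(X,ℤ) ⊕ H¹(X̂,ℤ)` with «`((w₁,θ₁),(w₂,θ₂))_V :=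
  θ₁(w₂) + θ₂(w₁)`» (p0003 L44). Held text `paper:arxiv-2502.03415` p0018 L54–L82.
* [Markman2025SurveySecant] = [Mar25b] E. Markman, arXiv:2509.23403, §1.1 («of split Weil type, if `H` has an isotropic subspace of half
  the dimension»).
* [Lange2023AbelianVarietiesComplex] H. Lange, *Abelian Varieties over the Complex Numbers* (2023), §7.3.3 Exercise (5)(a)(b); §1.5.1; §2.5.1;
  §1.4.1 (the canonical pairing `⟨ξ, v⟩ = Im ξ(v)`, dual lattice bases — tree `ComplexTorusDual`).
* [vanGeemen1994HodgeAV] = [vG94] B. van Geemen, LNM 1594 (1994), Lemma 5.2 (4) (signature via an orthogonal basis), 5.4.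
* Cell records: `s4push/prove-1/ATTEMPT-18.md` (g15), sheet `STATEMENTS-S3INPUT.md` S3INP-18, `HANDOFF-prove-1.md` §g15.
-/

noncomputable section

open Complex Module Matrix Literature.Geometry.Kaehler Literature.Geometry.Kaehler.ComplexTorus
open Literature.Geometry.Kaehler.ComplexTorus.WeilHermitian

namespace Summit.Ventures.HSemireg

namespace SecantParity

/-! ## §1 Hermitian linear algebra over `K = ℚ(√-d)`: an isotropic half forces signature `(m, m)` -/

section Hyperbolic

variable {d : ℕ} [NeZero d] {V : Type*} [AddCommGroup V] [Module (RatSqrtNeg d) V]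
  [Module.Finite (RatSqrtNeg d) V] (H : V →ₗ⋆[RatSqrtNeg d] V →ₗ[RatSqrtNeg d] RatSqrtNeg d)

/-- **A positive definite `K`-subspace and an isotropic `K`-subspace are disjoint, so their dimensions add up to at most
`dim_K V`** (real inertia, over `K`). [cite: vanGeemen1994HodgeAV, Lemma 5.2 (4) (proof)] -/
theorem finrank_add_finrank_le_of_pos_of_isotropic {P W : Submodule (RatSqrtNeg d) V}
    (hP : ∀ x ∈ P, x ≠ 0 → 0 < (H x x).re) (hW : ∀ x ∈ W, ∀ y ∈ W, H x y = 0) :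
    finrank (RatSqrtNeg d) P + finrank (RatSqrtNeg d) W ≤ finrank (RatSqrtNeg d) V := by
  refine Submodule.finrank_add_finrank_le_of_disjoint (Submodule.disjoint_def.2 fun x hxP hxW ↦ ?_)
  by_contra hx0
  have h1 := hP x hxP hx0
  rw [hW x hxW x hxW, QuadraticAlgebra.re_zero] at h1
  exact lt_irrefl _ h1

/-- **… and the same for a negative definite `K`-subspace.** [cite: vanGeemen1994HodgeAV, Lemma 5.2 (4) (proof)] -/
theorem finrank_add_finrank_le_of_neg_of_isotropic {P W : Submodule (RatSqrtNeg d) V}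
    (hP : ∀ x ∈ P, x ≠ 0 → (H x x).re < 0) (hW : ∀ x ∈ W, ∀ y ∈ W, H x y = 0) :
    finrank (RatSqrtNeg d) P + finrank (RatSqrtNeg d) W ≤ finrank (RatSqrtNeg d) V := by
  refine Submodule.finrank_add_finrank_le_of_disjoint (Submodule.disjoint_def.2 fun x hxP hxW ↦ ?_)
  by_contra hx0
  have h1 := hP x hxP hx0
  rw [hW x hxW x hxW, QuadraticAlgebra.re_zero] at h1
  exact lt_irrefl _ h1

omit [Module.Finite (RatSqrtNeg d) V] in
/-- `dim_K` of the span of a sub-family of a basis is its cardinality. [folklore] -/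
private theorem finrank_span_basis_subtype' {κ : Type*} [Fintype κ] (b : Module.Basis κ (RatSqrtNeg d) V)
    (p : κ → Prop) [DecidablePred p] :
    finrank (RatSqrtNeg d) (Submodule.span (RatSqrtNeg d) (Set.range fun i : {i // p i} ↦ b i)) =
      (Finset.univ.filter p).card := by
  have hli : LinearIndependent (RatSqrtNeg d) (fun i : {i // p i} ↦ b i) :=
    b.linearIndependent.comp (Subtype.val : {i // p i} → κ) Subtype.val_injective
  rw [finrank_span_eq_card hli, Fintype.card_subtype]

/-- **Inertia bookkeeping against an isotropic subspace.** For a non-degenerate Hermitian `H`, an `H`-orthogonal `K`-basis `b` and an ISOTROPIC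
`W`: the `K`-spans of the positive ∕ negative `bᵢ` are definite (Literature `re_apply_self_pos_of_mem_span` ∕ `_neg_`), hence disjoint from `W`,
and every `H(bᵢ, bᵢ)` is a non-zero rational: `#{> 0} + dim W ≤ dim V`, `#{< 0} + dim W ≤ dim V`, `#{> 0} + #{< 0} = dim V`. [cite: vanGeemen1994HodgeAV, Lemma 5.2 (4)] -/
theorem card_pos_card_neg_of_isotropic (hH : H.IsSymm) (hH' : H.SeparatingLeft) {W : Submodule (RatSqrtNeg d) V}
    (hW : ∀ x ∈ W, ∀ y ∈ W, H x y = 0) {κ : Type*} [Fintype κ] (b : Module.Basis κ (RatSqrtNeg d) V) (hb : H.IsOrthoᵢ b) :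
    (Finset.univ.filter fun i ↦ 0 < (H (b i) (b i)).re).card + finrank (RatSqrtNeg d) W ≤ finrank (RatSqrtNeg d) V ∧
      (Finset.univ.filter fun i ↦ (H (b i) (b i)).re < 0).card + finrank (RatSqrtNeg d) W ≤ finrank (RatSqrtNeg d) V ∧
        (Finset.univ.filter fun i ↦ 0 < (H (b i) (b i)).re).card +
          (Finset.univ.filter fun i ↦ (H (b i) (b i)).re < 0).card = finrank (RatSqrtNeg d) V := by
  classical
  have hbp : H.IsOrthoᵢ (fun i : {i // 0 < (H (b i) (b i)).re} ↦ b i) := fun i j hij ↦ hb (fun h' ↦ hij (Subtype.ext h'))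
  have hbn : H.IsOrthoᵢ (fun i : {i // (H (b i) (b i)).re < 0} ↦ b i) := fun i j hij ↦ hb (fun h' ↦ hij (Subtype.ext h'))
  have hP := finrank_add_finrank_le_of_pos_of_isotropic H
    (P := Submodule.span (RatSqrtNeg d) (Set.range fun i : {i // 0 < (H (b i) (b i)).re} ↦ b i))
    (fun x hx hx0 ↦ re_apply_self_pos_of_mem_span H hbp (fun i ↦ i.2) hx hx0) hW
  have hN := finrank_add_finrank_le_of_neg_of_isotropic H
    (P := Submodule.span (RatSqrtNeg d) (Set.range fun i : {i // (H (b i) (b i)).re < 0} ↦ b i))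
    (fun x hx hx0 ↦ re_apply_self_neg_of_mem_span H hbn (fun i ↦ i.2) hx hx0) hW
  rw [finrank_span_basis_subtype'] at hP hN
  refine ⟨hP, hN, ?_⟩
  -- every index is positive or negative: `H(bᵢ, bᵢ) ≠ 0`, and `Im H(bᵢ, bᵢ) = 0` since `\overline{H(x,x)} = H(x,x)` [vG94, 5.2 (2)]
  have him : ∀ i, (H (b i) (b i)).im = 0 := fun i ↦ by
    have h := congrArg QuadraticAlgebra.im (hH.eq (b i) (b i))
    rw [starRingEnd_apply, QuadraticAlgebra.im_star] at h
    linarith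
  have hneg : (Finset.univ.filter fun i ↦ (H (b i) (b i)).re < 0) = Finset.univ.filter fun i ↦ ¬0 < (H (b i) (b i)).re :=
    Finset.filter_congr fun i _ ↦ ⟨fun hi ↦ not_lt.2 hi.le, fun hi ↦
      lt_of_le_of_ne (not_lt.1 hi) fun h0 ↦ hb.not_isOrtho_basis_self_of_separatingLeft hH' i (QuadraticAlgebra.ext h0 (him i))⟩
  rw [hneg, Finset.card_filter_add_card_filter_not, Finset.card_univ, ← Module.finrank_eq_card_basis b]

/-- **Every ISOTROPIC `K`-subspace of a non-degenerate Hermitian form has `2·dim_K W ≤ dim_K V`** (Witt index at most half): an orthogonal basis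
exists (Literature `WeilHermitian.exists_orthogonal_basis`), its larger definite part has `dim ≥ dim V ∕ 2` and is disjoint from `W`. So an isotropic
subspace of HALF the dimension ([Mar25b §1.1] «split») is MAXIMAL. [cite: vanGeemen1994HodgeAV, Lemma 5.2 (4) and 5.4] [cite: Markman2025SurveySecant, §1.1] -/
theorem two_mul_finrank_le_of_isotropic (hH : H.IsSymm) (hH' : H.SeparatingLeft) {W : Submodule (RatSqrtNeg d) V}
    (hW : ∀ x ∈ W, ∀ y ∈ W, H x y = 0) : 2 * finrank (RatSqrtNeg d) W ≤ finrank (RatSqrtNeg d) V := by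
  obtain ⟨b, hb⟩ := exists_orthogonal_basis H hH
  obtain ⟨h1, h2, h3⟩ := card_pos_card_neg_of_isotropic H hH hH' hW b hb
  omega

/-- **SIGNATURE FROM AN ISOTROPIC HALF.** A non-degenerate Hermitian form `H` on a finite `K`-space `V` with an ISOTROPIC `K`-subspace `W`
of half the dimension (`2·dim_K W = dim_K V`) has signature `(dim W, dim W)`: in EVERY `H`-orthogonal `K`-basis `b` exactly `dim_K W` of the
rational numbers `H(bᵢ, bᵢ)` are `> 0` and exactly `dim_K W` are `< 0` (`card_pos_card_neg_of_isotropic` and arithmetic).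
[cite: vanGeemen1994HodgeAV, Lemma 5.2 (4) and 5.4] [cite: Markman2025SecantWeil, §3.1 Lemma 3.1.2] -/
theorem card_pos_eq_and_card_neg_eq_of_isotropic_half (hH : H.IsSymm) (hH' : H.SeparatingLeft)
    {W : Submodule (RatSqrtNeg d) V} (hW2 : 2 * finrank (RatSqrtNeg d) W = finrank (RatSqrtNeg d) V)
    (hW : ∀ x ∈ W, ∀ y ∈ W, H x y = 0) {κ : Type*} [Fintype κ] (b : Module.Basis κ (RatSqrtNeg d) V)
    (hb : H.IsOrthoᵢ b) :
    (Finset.univ.filter fun i ↦ 0 < (H (b i) (b i)).re).card = finrank (RatSqrtNeg d) W ∧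
      (Finset.univ.filter fun i ↦ (H (b i) (b i)).re < 0).card = finrank (RatSqrtNeg d) W := by
  obtain ⟨h1, h2, h3⟩ := card_pos_card_neg_of_isotropic H hH hH' hW b hb
  omega

/-- **Existence half of «signature `(m, m)`»: `K`-subspaces of `dim_K = dim W` on which `H` is POSITIVE, resp. NEGATIVE, definite**
(and none larger, `finrank_add_finrank_le_of_pos_of_isotropic` ∕ `…_neg_…`) — the spans of the positive ∕ negative vectors of an
`H`-orthogonal `K`-basis (Literature `WeilHermitian.exists_orthogonal_basis`). [cite: vanGeemen1994HodgeAV, Lemma 5.2 (4)] -/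
theorem exists_pos_neg_subspace_of_isotropic_half (hH : H.IsSymm) (hH' : H.SeparatingLeft)
    {W : Submodule (RatSqrtNeg d) V} (hW2 : 2 * finrank (RatSqrtNeg d) W = finrank (RatSqrtNeg d) V)
    (hW : ∀ x ∈ W, ∀ y ∈ W, H x y = 0) :
    ∃ P N : Submodule (RatSqrtNeg d) V, finrank (RatSqrtNeg d) P = finrank (RatSqrtNeg d) W ∧
      finrank (RatSqrtNeg d) N = finrank (RatSqrtNeg d) W ∧ (∀ x ∈ P, x ≠ 0 → 0 < (H x x).re) ∧ ∀ x ∈ N, x ≠ 0 → (H x x).re < 0 := by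
  classical
  obtain ⟨b, hb⟩ := exists_orthogonal_basis H hH
  have hbp : H.IsOrthoᵢ (fun i : {i // 0 < (H (b i) (b i)).re} ↦ b i) := fun i j hij ↦ hb (fun h' ↦ hij (Subtype.ext h'))
  have hbn : H.IsOrthoᵢ (fun i : {i // (H (b i) (b i)).re < 0} ↦ b i) := fun i j hij ↦ hb (fun h' ↦ hij (Subtype.ext h'))
  refine ⟨Submodule.span (RatSqrtNeg d) (Set.range fun i : {i // 0 < (H (b i) (b i)).re} ↦ b i),
    Submodule.span (RatSqrtNeg d) (Set.range fun i : {i // (H (b i) (b i)).re < 0} ↦ b i), ?_, ?_,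
    fun x hx hx0 ↦ re_apply_self_pos_of_mem_span H hbp (fun i ↦ i.2) hx hx0,
    fun x hx hx0 ↦ re_apply_self_neg_of_mem_span H hbn (fun i ↦ i.2) hx hx0⟩
  · rw [finrank_span_basis_subtype', (card_pos_eq_and_card_neg_eq_of_isotropic_half H hH hH' hW2 hW b hb).1]
  · rw [finrank_span_basis_subtype', (card_pos_eq_and_card_neg_eq_of_isotropic_half H hH hH' hW2 hW b hb).2]

end Hyperbolic

/-! ## §2 Markman's `(X × X̂, A)` with `Γ(a, c) = (a·G 0; 0 c·(ᵗG)⁻¹)`, `a = c·d`: `Re H`, isotropic half, signature `(n, n)` for EVERY `η` -/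

section Markman

variable {ι : Type*} [Fintype ι] [DecidableEq ι] {E : Type*} [NormedAddCommGroup E] [NormedSpace ℂ E]
  (Φ : (ι → ℝ) ≃L[ℝ] E) {η : E [⋀^Fin 2]→L[ℝ] ℝ}
  (hnd : ∀ u : E, (∀ v, η ![u, v] = 0) → u = 0) {G : Matrix ι ι ℤ} {d : ℕ}
  (α : SqrtNegMat (ι ⊕ ι) d)

local notation3 (prettyPrint := false) "Γ[" a ", " c "]" =>
  Matrix.fromBlocks (a • G.map (Int.cast : ℤ → ℚ)) 0 0 (c • (G.transpose.map (Int.cast : ℤ → ℚ))⁻¹)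

variable (hα : α.1 = Matrix.fromBlocks 0 (G.transpose.map (Int.cast : ℤ → ℚ))⁻¹ ((-(d : ℚ)) • G.transpose.map (Int.cast : ℤ → ℚ)) 0)

omit [Fintype ι] [DecidableEq ι] in
/-- `ℤ → ℚ → ℝ = ℤ → ℝ` on matrices. [folklore] -/
private theorem map_intCast_map_ratCast₄ {m n : Type*} (A : Matrix m n ℤ) :
    (A.map (Int.cast : ℤ → ℚ)).map (Rat.cast : ℚ → ℝ) = A.map (Int.cast : ℤ → ℝ) :=
  Matrix.ext fun i j ↦ Rat.cast_intCast (A i j)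

omit [Fintype ι] [DecidableEq ι] in
/-- The `ℚ`-vectors of the first half of a `ℤ`-basis of the lattice are `ℚ`-linearly independent.
[cite: Lange2023AbelianVarietiesComplex, §1.1.2 Prop. 1.1.10 (a) (proof, p. 20)] -/
private theorem linearIndependent_ratCast_basis_inl' {g : ℕ} (b : Module.Basis (Fin g ⊕ Fin g) ℤ (ι → ℤ)) :
    LinearIndependent ℚ (fun i : Fin g ↦ fun k : ι ↦ ((b (Sum.inl i) k : ℤ) : ℚ)) := by
  rw [← LinearIndependent.iff_fractionRing ℤ ℚ]
  let c : (ι → ℤ) →ₗ[ℤ] (ι → ℚ) :=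
    { toFun := fun m i ↦ (m i : ℚ)
      map_add' := fun m n ↦ funext fun i ↦ by simp
      map_smul' := fun z m ↦ funext fun i ↦ by simp }
  have hc : LinearMap.ker c = ⊥ := by
    rw [LinearMap.ker_eq_bot]
    intro x y hxy
    funext i
    have := congrFun hxy i
    simpa [c] using this
  exact (b.linearIndependent.comp _ Sum.inl_injective).map' c hc

include hnd in
/-- **`Γ(a, c)·A = -cd·(0 1; 1 0)` for `a = c·d` — independent of `η`**: `a·G·(ᵗG)⁻¹ = -a·1` (`ᵗG = -G`) and
`c·(ᵗG)⁻¹·(-d·ᵗG) = -cd·1`. The rational shadow of [Mar25 (3.1.2)]'s real part `d·(x, y)_V`: only `f` depends on the secant plane.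
[cite: Markman2025SecantWeil, §3.1 (3.1.2) and Lemma 3.1.2 (proof)] [cite: Lange2023AbelianVarietiesComplex, §2.5.1 Prop. 2.5.1] -/
theorem blockGram_mul_weilMatrix (hG : G.map (Int.cast : ℤ → ℝ) = latticeGram Φ η) {a c : ℚ} (ha : a = c * d) :
    Γ[a, c] * Matrix.fromBlocks 0 (G.transpose.map (Int.cast : ℤ → ℚ))⁻¹ ((-(d : ℚ)) • G.transpose.map (Int.cast : ℤ → ℚ)) 0 =
      (-(c * d)) • Matrix.fromBlocks (0 : Matrix ι ι ℚ) 1 1 0 := by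
  have hT := isUnit_det_transposeGram Φ hnd hG
  have hGT : G.map (Int.cast : ℤ → ℚ) = -G.transpose.map (Int.cast : ℤ → ℚ) := by
    rw [Matrix.transpose_map, transpose_map_intCast_gram Φ hG, neg_neg]
  have hB : a • G.map (Int.cast : ℤ → ℚ) * (G.transpose.map (Int.cast : ℤ → ℚ))⁻¹ = (-(c * d)) • (1 : Matrix ι ι ℚ) := by
    rw [Matrix.smul_mul, hGT, neg_mul, Matrix.mul_nonsing_inv _ hT, smul_neg, ← neg_smul, ha]
  have hC : c • (G.transpose.map (Int.cast : ℤ → ℚ))⁻¹ * ((-(d : ℚ)) • G.transpose.map (Int.cast : ℤ → ℚ)) =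
      (-(c * d)) • (1 : Matrix ι ι ℚ) := by
    rw [Matrix.smul_mul, Matrix.mul_smul, smul_smul, Matrix.nonsing_inv_mul _ hT, mul_neg]
  rw [Matrix.fromBlocks_multiply, Matrix.fromBlocks_smul, hB, hC]
  simp only [Matrix.zero_mul, Matrix.mul_zero, zero_add, add_zero, smul_zero]

include hnd hα in
/-- **`Re H_Γ` IS THE DUALITY PAIRING: `Re H_Γ(x, y) = -cd·(x₁·y₂ + x₂·y₁)`** for `x = (x₁, x₂)`, `y = (y₁, y₂) ∈ H₁(X, ℚ) ⊕ H₁(X̂, ℚ)` (lattice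
basis ∕ dual basis coordinates) — for EVERY `η`, every compatibility witness `hc'`: the real part of Markman's Hermitian form does not see `η`
at all; `η` enters only through the `K`-structure `A` and `Im H_Γ = Γ`. Print (3.1.2): «`H(x,y) := d(x,y)_V + √-d(f(x),y)_V`», «The quadratic
form depends only on the real part of `H`.» [cite: Markman2025SecantWeil, §3.1 (3.1.2) and Lemma 3.1.2 (proof)]
[cite: Lange2023AbelianVarietiesComplex, §7.3.3 Exercise (5)(a)] -/
theorem hermForm_weilMatrix_re [NeZero d] (hG : G.map (Int.cast : ℤ → ℝ) = latticeGram Φ η) {a c : ℚ} (ha : a = c * d)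
    (hc' : α.1ᵀ * Γ[a, c] * α.1 = (d : ℚ) • Γ[a, c]) (x y : WeilVec α) :
    (hermForm Γ[a, c] α hc' x y).re =
      -(c * d) * ((WeilVec.toVec α x ∘ Sum.inl) ⬝ᵥ (WeilVec.toVec α y ∘ Sum.inr) +
        (WeilVec.toVec α x ∘ Sum.inr) ⬝ᵥ (WeilVec.toVec α y ∘ Sum.inl)) := by
  rw [hermForm_apply, hermFun_re, ratForm, Matrix.mulVec_mulVec, hα, blockGram_mul_weilMatrix Φ hnd hG ha, Matrix.smul_mulVec,
    dotProduct_smul, smul_eq_mul, Matrix.fromBlocks_mulVec]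
  congr 1
  conv_lhs => rw [← Sum.elim_comp_inl_inr (WeilVec.toVec α x)]
  rw [sumElim_dotProduct_sumElim, Matrix.zero_mulVec, Matrix.zero_mulVec, Matrix.one_mulVec, Matrix.one_mulVec, zero_add,
    add_zero]

include hnd hα in
/-- **… intrinsically: `Re H_Γ(x, y) = -cd·(⟨x̂₂, y₁⟩ + ⟨ŷ₂, x₁⟩)` for Lange's canonical pairing `⟨ξ, v⟩ = Im ξ(v)` between `H₁(X̂, ℝ) = Ω̄` and
`H₁(X, ℝ) = V`** (`x = (x₁, x₂)`, `y = (y₁, y₂)` in `H₁(X, ℚ) ⊕ H₁(X̂, ℚ)`, `x̂₂ = Φ̂(x₂)`; the lattice bases of `X` and `X̂` are dual for `⟨ , ⟩`,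
tree `im_dualPeriod_apply`) — print's symmetric pairing `((w₁,θ₁),(w₂,θ₂))_V := θ₁(w₂) + θ₂(w₁)` on `H¹(X) ⊕ H¹(X)^*`, read on the homology
side: `Re H_Γ = -cd·(•,•)_V` for EVERY `η`. [cite: Markman2025SecantWeil, §1.2 (the pairing on `V = H¹(X,ℤ) ⊕ H¹(X̂,ℤ)`) and §3.1 (3.1.2)]
[cite: Lange2023AbelianVarietiesComplex, §1.4.1 (canonical pairing `Ω̄ × V → ℝ`)] -/
theorem hermForm_weilMatrix_re_eq_pairing [NeZero d] (hG : G.map (Int.cast : ℤ → ℝ) = latticeGram Φ η) {a c : ℚ}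
    (ha : a = c * d) (hc' : α.1ᵀ * Γ[a, c] * α.1 = (d : ℚ) • Γ[a, c]) (x y : WeilVec α) :
    ((hermForm Γ[a, c] α hc' x y).re : ℝ) =
      -(c * d) * ((dualPeriod Φ (ratVec (WeilVec.toVec α x ∘ Sum.inr)) (Φ (ratVec (WeilVec.toVec α y ∘ Sum.inl)))).im +
        (dualPeriod Φ (ratVec (WeilVec.toVec α y ∘ Sum.inr)) (Φ (ratVec (WeilVec.toVec α x ∘ Sum.inl)))).im) := by
  have hcast : ∀ u v : ι → ℚ, ratVec u ⬝ᵥ ratVec v = ((u ⬝ᵥ v : ℚ) : ℝ) := fun u v ↦ by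
    rw [dotProduct, dotProduct, Rat.cast_sum]
    simp only [ratVec_apply, Rat.cast_mul]
  rw [im_dualPeriod_apply, im_dualPeriod_apply, hcast, hcast, hermForm_weilMatrix_re Φ hnd α hα hG ha hc',
    dotProduct_comm (WeilVec.toVec α y ∘ Sum.inr)]
  push_cast
  ring

include hnd hα in
/-- **AN ISOTROPIC `K`-SUBSPACE OF HALF THE DIMENSION — FOR EVERY `η` (no positivity).** For `η ∈ NS(X)` non-degenerate with integer Gram
matrix `G` (ANY index), `d ≥ 1`, any square root `α` of `-d` over Markman's `A`, any rational `a, c` and ANY compatibility witness `hc'`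
(`ᵗA Γ A = d Γ`; proved for `a = c·d` by XIIg `weilMatrix_compat_blockGram`): `H_Γ` has an ISOTROPIC `K`-subspace `W` with `2·dim_K W =
dim_K H₁(X × X̂, ℚ)` — the `K`-span of the `(b_{inl i}, 0)` for a Lagrangian half of a symplectic basis of `η` (a polarisation TYPE exists for every
non-degenerate `η`). XIIf proved this for POLARISED `h`; the witness uses no positivity. «split Weil type, if `H` has an isotropic subspace of half the dimension.»
[cite: Markman2025SurveySecant, §1.1] [cite: Markman2025SecantWeil, §3.1 Lemma 3.1.2] [cite: Lange2023AbelianVarietiesComplex, §1.5.1] -/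
theorem exists_isotropic_half_hermForm_weilMatrix [NeZero d] (hη : IsNSForm Φ η)
    (hG : G.map (Int.cast : ℤ → ℝ) = latticeGram Φ η) {a c : ℚ} (hc' : α.1ᵀ * Γ[a, c] * α.1 = (d : ℚ) • Γ[a, c]) :
    ∃ W : Submodule (RatSqrtNeg d) (WeilVec α),
      2 * finrank (RatSqrtNeg d) W = finrank (RatSqrtNeg d) (WeilVec α) ∧ ∀ x ∈ W, ∀ y ∈ W, hermForm Γ[a, c] α hc' x y = 0 := by
  -- a symplectic basis of `η` on the lattice of `X` (a polarisation TYPE exists for every non-degenerate `η ∈ NS(X)`)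
  have hnd' : ∀ v : E, v ≠ 0 → ∃ w : E, η ![v, w] ≠ 0 := fun v hv ↦ not_forall.1 fun h0 ↦ hv (hnd v h0)
  obtain ⟨g', δ, hδ, -⟩ := hη.exists_isPolarizationType_of_nondegenerate Φ hnd'
  have hcard : Fintype.card ι = 2 * g' := hδ.card_eq
  obtain ⟨-, bZ, hll, -, -⟩ := hδ
  -- its Lagrangian half, as rational first-block vectors
  set w : Fin g' → ι → ℚ := fun i k ↦ ((bZ (Sum.inl i) k : ℤ) : ℚ) with hw_def
  have hGQ : (G.map (Int.cast : ℤ → ℚ)).map (Rat.cast : ℚ → ℝ) = latticeGram Φ η := by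
    rw [map_intCast_map_ratCast₄, hG]
  have hwG : ∀ i j, w i ⬝ᵥ ((a • G.map (Int.cast : ℤ → ℚ)) *ᵥ w j) = 0 := fun i j ↦ by
    rw [Matrix.smul_mulVec, dotProduct_smul, smul_eq_mul]
    refine mul_eq_zero_of_right _ ?_
    apply Rat.cast_injective (α := ℝ)
    rw [ratCast_dotProduct_mulVec Φ hGQ, Rat.cast_zero, hw_def, ← intVec_eq_ratVec, ← intVec_eq_ratVec]
    exact hll i j
  have hC : ((-(d : ℚ)) • G.transpose.map (Int.cast : ℤ → ℚ)).det ≠ 0 := by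
    rw [Matrix.det_smul]
    exact mul_ne_zero (pow_ne_zero _ (neg_ne_zero.2 (Nat.cast_ne_zero.2 (NeZero.ne d))))
      (isUnit_det_transposeGram Φ hnd hG).ne_zero
  have hli := linearIndependent_sumElim_inl (G.transpose.map (Int.cast : ℤ → ℚ))⁻¹
    ((-(d : ℚ)) • G.transpose.map (Int.cast : ℤ → ℚ)) α hα hC w (linearIndependent_ratCast_basis_inl' bZ)
  refine ⟨Submodule.span (RatSqrtNeg d) (Set.range fun i ↦ (WeilVec.toVec α).symm (Sum.elim (w i) 0)), ?_,
    fun x hx y hy ↦ ?_⟩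
  · rw [finrank_span_eq_card hli, Fintype.card_fin, finrank_weilVec_sum α, hcard]
  · exact hermForm_eq_zero_of_mem_span_inl (a • G.map (Int.cast : ℤ → ℚ)) (c • (G.transpose.map (Int.cast : ℤ → ℚ))⁻¹)
      (G.transpose.map (Int.cast : ℤ → ℚ))⁻¹ ((-(d : ℚ)) • G.transpose.map (Int.cast : ℤ → ℚ)) α hα hc' w hwG hx hy

include hnd hα in
/-- **The isotropic half is MAXIMAL: every `H_Γ`-isotropic `K`-subspace has `2·dim_K ≤ dim_K H₁(X × X̂, ℚ)`** — for every `η`, `d`, `c ≠ 0`,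
`a = c·d`: the Witt index of Markman's Hermitian form is EXACTLY `dim_ℂ X` (with `exists_isotropic_half_hermForm_weilMatrix`).
[cite: Markman2025SurveySecant, §1.1] [cite: Markman2025SecantWeil, §3.1 Lemma 3.1.2] -/
theorem two_mul_finrank_le_of_isotropic_hermForm_weilMatrix [NeZero d] (hG : G.map (Int.cast : ℤ → ℝ) = latticeGram Φ η) {a c : ℚ}
    (ha : a = c * d) (hc : c ≠ 0) {W : Submodule (RatSqrtNeg d) (WeilVec α)}
    (hW : ∀ x ∈ W, ∀ y ∈ W, hermForm Γ[a, c] α (weilMatrix_compat_blockGram Φ hnd α hα hG ha) x y = 0) :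
    2 * finrank (RatSqrtNeg d) W ≤ finrank (RatSqrtNeg d) (WeilVec α) :=
  two_mul_finrank_le_of_isotropic _ (isSymm_hermForm _ (transpose_blockGram Φ hnd hG a c))
    (nondegenerate_hermForm _ (det_blockGram_ne_zero Φ hnd hG (ne_zero_of_eq_mul_natCast ha hc) hc)).1 hW

include hnd hα in
/-- **[Mar25 LEMMA 3.1.2] WITHOUT POSITIVITY — THE SIGNATURE OF MARKMAN'S HERMITIAN FORM IS `(n, n)`, `n = dim_ℂ X`, FOR EVERY
non-degenerate `η ∈ NS(X)` (polarising or not), every `d ≥ 1`, all rational `a, c` and ALL witnesses `hc'` (`ᵗA Γ A = d Γ`), `hGt'` (`ᵗΓ = -Γ`),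
`hdet'` (`det Γ ≠ 0`) — PROVED for `a = c·d`, `c ≠ 0` by XIIg `weilMatrix_compat_blockGram`, `transpose_blockGram`, `det_blockGram_ne_zero`.**
In every `H_Γ`-orthogonal `K`-basis `b` of `H₁(X × X̂, ℚ)` exactly `dim_ℂ X` of the rationals `H_Γ(bᵢ, bᵢ)` are positive and exactly `dim_ℂ X`
are negative — the print's definition of «signature `(a, b)`» verbatim; «The signature of `H` is `(n, n)`.» (printed proof via `Re H = d·(•,•)_V`
of signature `(2n, 2n)`; here via the isotropic half and §1). [cite: Markman2025SecantWeil, §3.1 Lemma 3.1.2]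
[cite: Lange2023AbelianVarietiesComplex, §7.3.3 Exercise (5)(b)] [cite: vanGeemen1994HodgeAV, Lemma 5.2 (4)] -/
theorem card_pos_eq_and_card_neg_eq_hermForm_blockGram_weilMatrix [NeZero d] (hη : IsNSForm Φ η)
    (hG : G.map (Int.cast : ℤ → ℝ) = latticeGram Φ η) {a c : ℚ} (hc' : α.1ᵀ * Γ[a, c] * α.1 = (d : ℚ) • Γ[a, c])
    (hGt' : (Γ[a, c])ᵀ = -Γ[a, c]) (hdet' : (Γ[a, c]).det ≠ 0)
    {κ : Type*} [Fintype κ] (b : Module.Basis κ (RatSqrtNeg d) (WeilVec α)) (hb : (hermForm Γ[a, c] α hc').IsOrthoᵢ b) :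
    (Finset.univ.filter fun i ↦ 0 < (hermForm Γ[a, c] α hc' (b i) (b i)).re).card = finrank ℂ E ∧
      (Finset.univ.filter fun i ↦ (hermForm Γ[a, c] α hc' (b i) (b i)).re < 0).card = finrank ℂ E := by
  haveI : FiniteDimensional ℝ E := LinearEquiv.finiteDimensional Φ.toLinearEquiv
  haveI : FiniteDimensional ℂ E := Module.Finite.of_restrictScalars_finite ℝ ℂ E
  obtain ⟨W, hW2, hW⟩ := exists_isotropic_half_hermForm_weilMatrix Φ hnd α hα hη hG hc'
  have h1 := finrank_weilVec_sum α
  have h2 := card_eq_two_mul_finrank Φ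
  rw [show finrank ℂ E = finrank (RatSqrtNeg d) W by omega]
  exact card_pos_eq_and_card_neg_eq_of_isotropic_half _ (isSymm_hermForm hc' hGt') (nondegenerate_hermForm hc' hdet').1
    hW2 hW b hb

include hnd hα in
/-- **Hypothesis-free form of [Mar25 Lemma 3.1.2]: for EVERY non-degenerate `η ∈ NS(X)`, every `d ≥ 1` and every rational scale `c ≠ 0`,
Markman's Hermitian `K`-space `(H₁(X × X̂, ℚ), H_{Γ(c d, c)})` has signature `(dim_ℂ X, dim_ℂ X)`** (witnesses discharged by XIIg). With
XIIg `discr_hermForm_weilMatrix`: (signature, discriminant) `= ((n, n), [(-1)ⁿ])` for every secant direction — BLIND to the index of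
`b`. [cite: Markman2025SecantWeil, §3.1 Lemma 3.1.2] [cite: Lange2023AbelianVarietiesComplex, §7.3.3 Exercise (5)(b)] -/
theorem card_pos_eq_and_card_neg_eq_hermForm_weilMatrix [NeZero d] (hη : IsNSForm Φ η)
    (hG : G.map (Int.cast : ℤ → ℝ) = latticeGram Φ η) {a c : ℚ} (ha : a = c * d) (hc : c ≠ 0)
    {κ : Type*} [Fintype κ] (b : Module.Basis κ (RatSqrtNeg d) (WeilVec α))
    (hb : (hermForm Γ[a, c] α (weilMatrix_compat_blockGram Φ hnd α hα hG ha)).IsOrthoᵢ b) :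
    (Finset.univ.filter fun i ↦
        0 < (hermForm Γ[a, c] α (weilMatrix_compat_blockGram Φ hnd α hα hG ha) (b i) (b i)).re).card = finrank ℂ E ∧
      (Finset.univ.filter fun i ↦
        (hermForm Γ[a, c] α (weilMatrix_compat_blockGram Φ hnd α hα hG ha) (b i) (b i)).re < 0).card = finrank ℂ E :=
  card_pos_eq_and_card_neg_eq_hermForm_blockGram_weilMatrix Φ hnd α hα hη hG (weilMatrix_compat_blockGram Φ hnd α hα hG ha)
    (transpose_blockGram Φ hnd hG a c) (det_blockGram_ne_zero Φ hnd hG (ne_zero_of_eq_mul_natCast ha hc) hc) b hb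

end Markman

/-! ## §3 The lane's counter-model direction `η₄ = e₁ + e₂ + e₃ − e₄` on `E_τ⁴` (index `1`; polarised for NEITHER orientation) -/

section EFour

variable {τ : ℂ} (hτ : 0 < τ.im) {G₄ : Matrix ((Fin 2 ⊕ Fin 2) ⊕ (Fin 2 ⊕ Fin 2)) ((Fin 2 ⊕ Fin 2) ⊕ (Fin 2 ⊕ Fin 2)) ℤ}

local notation3 (prettyPrint := false) "Γ₄[" a ", " c "]" =>
  Matrix.fromBlocks (a • G₄.map (Int.cast : ℤ → ℚ)) 0 0 (c • (G₄.transpose.map (Int.cast : ℤ → ℚ))⁻¹)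

/-- **THE INTERMEDIATE-INDEX CASE: signature `(4, 4)` all the same.** On `X = E_τ⁴` the secant direction `η₄ = e₁ + e₂ + e₃ − e₄` (integer
Gram matrix `G₄ = ((J 0; 0 J) 0; 0 (J 0; 0 −J))` — the hypothesis `hG`, discharged by XIIg `eFourGram_map_intCast hτ`) has index `1`,
`∫_X η₄⁴ = −24 < 0` ((H1) FAILS, file IVb), and `(X × X̂, ±Ξ_d, A)` is polarised of Weil type for NEITHER orientation (XIId `hermIndex_Xi_eFour`),
so the Literature theorem `IsPolarizedWeilType.card_pos_eq_and_card_neg_eq` is EMPTY there. Nevertheless, for every `d ≥ 1`, `a = c·d`, `c ≠ 0`,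
every `α` over Markman's `A` and every `H_Γ`-orthogonal `K`-basis of the `8`-dimensional `K`-space `H₁(X × X̂, ℚ)`: **exactly `4` diagonal entries
are positive and exactly `4` negative** — signature `(4, 4) = (dim X, dim X)`. [cite: Markman2025SecantWeil, §3.1 Lemma 3.1.2]
[cite: Lange2023AbelianVarietiesComplex, §7.3.3 Exercise (5)(b)] -/
theorem card_pos_eq_and_card_neg_eq_hermForm_weilMatrix_eFour {d : ℕ} [NeZero d]
    (hG : G₄.map (Int.cast : ℤ → ℝ) =
      latticeGram (prodPeriod (prodPeriod (ellipticPeriod hτ.ne') (ellipticPeriod hτ.ne'))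
          (prodPeriod (ellipticPeriod hτ.ne') (ellipticPeriod hτ.ne')))
        (prodForm (prodForm (ellipticForm hτ.ne') (ellipticForm hτ.ne')) (prodForm (ellipticForm hτ.ne') (-ellipticForm hτ.ne'))))
    (α : SqrtNegMat (((Fin 2 ⊕ Fin 2) ⊕ (Fin 2 ⊕ Fin 2)) ⊕ ((Fin 2 ⊕ Fin 2) ⊕ (Fin 2 ⊕ Fin 2))) d)
    (hα : α.1 = Matrix.fromBlocks 0 (G₄.transpose.map (Int.cast : ℤ → ℚ))⁻¹ ((-(d : ℚ)) • G₄.transpose.map (Int.cast : ℤ → ℚ)) 0)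
    {a c : ℚ} (ha : a = c * d) (hc : c ≠ 0) {κ : Type*} [Fintype κ] (b : Module.Basis κ (RatSqrtNeg d) (WeilVec α))
    (hb : (hermForm Γ₄[a, c] α (weilMatrix_compat_blockGram _ (eq_zero_of_forall_eFour_apply_eq_zero hτ) α hα hG ha)).IsOrthoᵢ b) :
    (Finset.univ.filter fun i ↦ 0 < (hermForm Γ₄[a, c] α
        (weilMatrix_compat_blockGram _ (eq_zero_of_forall_eFour_apply_eq_zero hτ) α hα hG ha) (b i) (b i)).re).card = 4 ∧
      (Finset.univ.filter fun i ↦ (hermForm Γ₄[a, c] α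
        (weilMatrix_compat_blockGram _ (eq_zero_of_forall_eFour_apply_eq_zero hτ) α hα hG ha) (b i) (b i)).re < 0).card = 4 := by
  have key := card_pos_eq_and_card_neg_eq_hermForm_weilMatrix _ (eq_zero_of_forall_eFour_apply_eq_zero hτ) α hα
    (isNSForm_eFour hτ) hG ha hc b hb
  rwa [show finrank ℂ ((ℂ × ℂ) × (ℂ × ℂ)) = 4 by simp only [Module.finrank_prod, Module.finrank_self]] at key

end EFour

end SecantParity

end Summit.Ventures.HSemireg
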